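import Summits.Ventures.HSemireg.EmbeddedFirstOrderDeformationsCechMinusTwoCurve
import Summits.Ventures.HSemireg.EmbeddedFirstOrderDeformationsCechMinusOneRigid

/-!
# Venture HSemireg — `Ȟ⁰(Z, 𝒩) = 0` for the `(−2)`-atlas as well (`H⁰(ℙ¹, 𝒪(−2)) = 0`): the `h⁰` column of the
# ladder `𝒪(0)` / `𝒪(−1)` / `𝒪(−2)` of `…CechTrivialBundle` is kernel-checked on every rung

HONEST FRAMING.  Lean side of the computation cell `pub-hsemireg` (track «S4-PUSH» (ii), seat s4-prove-3 g6, second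
route for (S5)); log `s4push/prove-3/ATTEMPT-10.md` §5j.  For the `(−2)`-atlas of `…CechMinusTwoCurve` no lift
exists at all, so the torsor statement is vacuous there; but the group `Ȟ⁰` acting on lifts is defined for any base
local lifts, and this file shows it VANISHES: a compatible pair `(ψ₀, ψ₁)` gives `s²·a(s) ≡ b(s⁻¹)`, i.e.
`x²·a(x) = b(x⁻¹)` in `k[x]_x`, forcing `a = b = 0` (`eq_zero_of_laurent_identity_pow`, any exponent `m ≥ 1`).
Plain commutative algebra; no Mathlib scheme, sheaf, abelian variety or semiregularity map; nothing here says that HC,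
HC_CM or HC_AV holds; no object is certified; no Literature fact is declared.

WHAT (namespace `Summit.Ventures.HSemireg.EmbeddedDeformation.DoubledLine`):
* `eq_zero_of_laurent_identity_pow` — in `k[x]_x` with `u·x = 1` and `m ≥ 1`: `x^m·a(x) = b(u)` forces `a = b = 0`;
* **`compatible_eq_zero_minusTwo`** — every compatible family for the `(−2)`-atlas (any base lifts) is `0`.

References: R. Hartshorne, *Deformation Theory*, GTM 257 (2010), §6 Thm. 6.2 (b) [corpus:
book:springernd-deformation-theory p0054]; `H⁰(ℙ¹, 𝒪(−2)) = 0` [folklore].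
-/

namespace Summit.Ventures.HSemireg

namespace EmbeddedDeformation

namespace DoubledLine

open DualNumber TrivSqZeroExt MvPolynomial

universe u

variable (k : Type u) [CommRing k]

/-- In `k[x]_x` with `u·x = 1` and `m ≥ 1`: if `x^m·a(x) = b(u)` then `a = 0` and `b = 0` (multiply by `x^N`,
`N = deg b`: `a·x^{N+m} = reflect N b` in `k[x]`, of degree `≤ N`). [folklore] -/
theorem eq_zero_of_laurent_identity_pow (m : ℕ) (hm : 1 ≤ m) (a b : Polynomial k)
    {u : Localization.Away (Polynomial.X : Polynomial k)}
    (hu : u * algebraMap (Polynomial k) (Localization.Away (Polynomial.X : Polynomial k)) Polynomial.X = 1)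
    (h : algebraMap (Polynomial k) (Localization.Away (Polynomial.X : Polynomial k)) Polynomial.X ^ m *
        algebraMap (Polynomial k) _ a = Polynomial.eval₂ (algebraMap k _) u b) : a = 0 ∧ b = 0 := by
  set x : Localization.Away (Polynomial.X : Polynomial k) :=
    algebraMap (Polynomial k) (Localization.Away (Polynomial.X : Polynomial k)) Polynomial.X with hx
  haveI : Invertible x := ⟨u, hu, by rw [mul_comm]; exact hu⟩
  have hux : ⅟x = u := invOf_eq_left_inv hu
  have hrr : Polynomial.reflect b.natDegree (Polynomial.reflect b.natDegree b) = b :=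
    Polynomial.ext fun i ↦ by rw [Polynomial.coeff_reflect, Polynomial.coeff_reflect, Polynomial.revAt_invol]
  have hdeg : (Polynomial.reflect b.natDegree b).natDegree ≤ b.natDegree :=
    Polynomial.natDegree_le_iff_coeff_eq_zero.2 fun i hi ↦ by
      rw [Polynomial.coeff_reflect, Polynomial.revAt_eq_self_of_lt hi]
      exact Polynomial.coeff_eq_zero_of_natDegree_lt hi
  have hev : ∀ q : Polynomial k,
      Polynomial.eval₂ (algebraMap k (Localization.Away (Polynomial.X : Polynomial k))) x q =
        algebraMap (Polynomial k) (Localization.Away (Polynomial.X : Polynomial k)) q := by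
    intro q
    have e : Polynomial.eval₂RingHom (algebraMap k (Localization.Away (Polynomial.X : Polynomial k))) x =
        algebraMap (Polynomial k) (Localization.Away (Polynomial.X : Polynomial k)) :=
      Polynomial.ringHom_ext (fun c ↦ by
          rw [Polynomial.coe_eval₂RingHom, Polynomial.eval₂_C, IsScalarTower.algebraMap_apply k (Polynomial k)
            (Localization.Away (Polynomial.X : Polynomial k)) c, Polynomial.algebraMap_eq])
        (by rw [Polynomial.coe_eval₂RingHom, Polynomial.eval₂_X])
    exact DFunLike.congr_fun e q
  have h1 : Polynomial.eval₂ (algebraMap k _) u b * x ^ b.natDegree =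
      algebraMap (Polynomial k) _ (Polynomial.reflect b.natDegree b) := by
    have := Polynomial.eval₂_reflect_mul_pow (algebraMap k (Localization.Away (Polynomial.X : Polynomial k))) x
      b.natDegree (Polynomial.reflect b.natDegree b) hdeg
    rw [hrr, hux, hev] at this
    exact this
  have h3 : algebraMap (Polynomial k) (Localization.Away (Polynomial.X : Polynomial k))
      (a * Polynomial.X ^ (b.natDegree + m)) = algebraMap (Polynomial k) _ (Polynomial.reflect b.natDegree b) := by
    rw [← h1, ← h, map_mul, map_pow, ← hx]
    ring
  have hinj : Function.Injective (algebraMap (Polynomial k) (Localization.Away (Polynomial.X : Polynomial k))) :=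
    IsLocalization.injective _ (Submonoid.powers_le.2 (mem_nonZeroDivisors_iff_right.2 fun q hq ↦
      (Polynomial.isRegular_X (R := k)).right (show q * Polynomial.X = 0 * Polynomial.X by rw [hq, zero_mul])))
  have h4 : a * Polynomial.X ^ (b.natDegree + m) = Polynomial.reflect b.natDegree b := hinj h3
  have ha : a = 0 := by
    rcases subsingleton_or_nontrivial k with hk | hk
    · exact Polynomial.ext fun i ↦ Subsingleton.elim _ _
    · by_contra ha
      have hd := congrArg Polynomial.natDegree h4
      rw [Polynomial.natDegree_mul_X_pow (b.natDegree + m) ha] at hd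
      omega
  refine ⟨ha, ?_⟩
  rw [ha, zero_mul] at h4
  rw [← hrr, ← h4, Polynomial.reflect_zero]

/-- **`Ȟ⁰(Z, 𝒩) = 0` for the `(−2)`-atlas** (`H⁰(ℙ¹, 𝒪(−2)) = 0`): a compatible family `ψ` (`ψ₀|_{αβ} = ψ_β|_{αβ}`
along the chart maps `resM2` of `𝒪_{ℙ¹}(−2)`, any base local lifts) is ZERO — at the generator,
`s²·a(s,p) ≡ psi(b) (mod p)`, i.e. `x²·a(x,0) = b(x⁻¹,0)` in `k[x]_x`. [cite: Hartshorne2010, §6 Thm. 6.2 (b)] -/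
theorem compatible_eq_zero_minusTwo {T : ∀ α : Fin 2, Ideal (A k)[ε]}
    (hT : ∀ α, IsLift (fstRingHom (A k)) (ε : (A k)[ε]) (idealZ k α) (T α))
    (ψ : ∀ α : Fin 2, idealZ k α →ₗ[A k] A k ⧸ idealZ k α)
    (hψ : ∀ α β, resL (thickenedAtlas_minusTwo k) hT α β (ψ α) = resR (thickenedAtlas_minusTwo k) hT α β (ψ β)) :
    ψ = 0 := by
  have 𝔄 := thickenedAtlas_minusTwo k
  have hX1 : (X 1 : A k) ∈ idealZ k 0 := Ideal.subset_span rfl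
  have hX1' : (X 1 : A k) ∈ idealZ k 1 := Ideal.subset_span rfl
  have hmem : algebraMap (A k) (L k) (X 1) ∈ idealZ₂ k 0 1 := Ideal.mem_map_of_mem _ (Ideal.subset_span rfl)
  have hmem₁ : resM2 k 1 (X 1) ∈ idealZ₂ k 0 1 := by
    rw [resM2_one_X_one]
    exact Ideal.mul_mem_left _ _ hmem
  obtain ⟨a, ha⟩ := Ideal.Quotient.mk_surjective (ψ 0 ⟨X 1, hX1⟩)
  obtain ⟨b, hb⟩ := Ideal.Quotient.mk_surjective (ψ 1 ⟨X 1, hX1'⟩)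
  have e0 : resL (thickenedAtlas_minusTwo k) hT 0 1 (ψ 0) ⟨algebraMap (A k) (L k) (X 1), hmem⟩ =
      Ideal.Quotient.mk (idealZ₂ k 0 1) (algebraMap (A k) (L k) a) :=
    resNormal_apply (𝔄.homl 0 1) (𝔄.liftsl 0 1) (hT 0) (ψ 0) ⟨X 1, hX1⟩ a ha hmem
  have e1 : resR (thickenedAtlas_minusTwo k) hT 0 1 (ψ 1) ⟨resM2 k 1 (X 1), hmem₁⟩ =
      Ideal.Quotient.mk (idealZ₂ k 0 1) (resM2 k 1 b) :=
    resNormal_apply (𝔄.homr 0 1) (𝔄.liftsr 0 1) (hT 1) (ψ 1) ⟨X 1, hX1'⟩ b hb hmem₁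
  have hx1 : (⟨resM2 k 1 (X 1), hmem₁⟩ : idealZ₂ k 0 1) =
      (algebraMap (A k) (L k) (X 0) ^ 2) • (⟨algebraMap (A k) (L k) (X 1), hmem⟩ : idealZ₂ k 0 1) :=
    Subtype.ext (by
      show resM2 k 1 (X 1) = algebraMap (A k) (L k) (X 0) ^ 2 • algebraMap (A k) (L k) (X 1)
      rw [resM2_one_X_one, smul_eq_mul])
  rw [hx1, ← hψ 0 1, map_smul, e0] at e1
  have hsm : ∀ c z : L k, c • Ideal.Quotient.mk (idealZ₂ k 0 1) z = Ideal.Quotient.mk (idealZ₂ k 0 1) (c * z) :=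
    fun _ _ ↦ rfl
  rw [hsm, Ideal.Quotient.eq] at e1
  have hev := ev_eq_zero_of_mem k e1
  rw [map_sub, map_mul, map_pow, ev_algebraMap_X_zero, ev_algebraMap_eq k a, resM2_one, RingHom.comp_apply]
    at hev
  change _ - ev k (psiHom k (algebraMap (A k) (L k) b)) = 0 at hev
  rw [psiHom_algebraMap, ← RingHom.comp_apply (ev k) (psi₀ k), ev_comp_psi₀, eval₂Hom_pair_zero, sub_eq_zero]
    at hev
  have hinv : ev k (IsLocalization.Away.invSelf (X 0 : A k)) *
      algebraMap (Polynomial k) (Localization.Away (Polynomial.X : Polynomial k)) Polynomial.X = 1 := by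
    rw [← ev_algebraMap_X_zero, ← map_mul, mul_comm, IsLocalization.Away.mul_invSelf, map_one]
  obtain ⟨ha0, hb0⟩ := eq_zero_of_laurent_identity_pow k 2 (by norm_num) _ _ hinv hev
  have h0 : ψ 0 = 0 := ext_of_X_one k hX1 (by rw [ha.symm, LinearMap.zero_apply, mk_eq_zero_of_spec_eq_zero k 0 ha0])
  have h1 : ψ 1 = 0 :=
    ext_of_X_one k hX1' (by rw [hb.symm, LinearMap.zero_apply, mk_eq_zero_of_spec_eq_zero k 1 hb0])
  funext α
  fin_cases α
  · exact h0
  · exact h1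

end DoubledLine

end EmbeddedDeformation

end Summit.Ventures.HSemireg
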